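import Mathlib.Analysis.Normed.Group.FunctionSeries
import Mathlib.Analysis.PSeries
import Literature.Barriers.CriticalPhenomena.WeaklySAWQuadraticFlowCutoff
import HarnessLib

/-!
# [BBS-rg-flow, Proposition 1.2, continuity clause]: the flow `V̄_j = (ḡ_j, z̄_j, μ̄_j)` of `φ̄` is
# continuous in an external parameter (jointly with the initial condition `g₀`)

Fourteenth file of the series formalising [BBS-rg-flow] (Bauerschmidt–Brydges–Slade, AHP 16 (2015),
arXiv:1211.2477), the abstract dynamical-system input of BBS 2015, Theorem 4.1 (via its Theorem 7.2.1),
towards `Literature.Barriers.CriticalPhenomena.WeaklySAWFourDimLogCorrections`; it completes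
`WeaklySAWQuadraticFlowCutoff.lean` (Proposition 1.2: existence, uniqueness, bounds) with the last
sentence of Proposition 1.2: "if the maps `φ̄_j` depend continuously on an external parameter such that
(A1–A2) hold with uniform constants, then `V̄_j` is continuous in this parameter, for every `j`" — the
input of [BBS-rg-flow, Corollary 1.8] (continuity of the critical flow in the external parameter),
which is what BBS 2015, §8 uses to construct the critical point.

For a family `m ↦ φ̄(m)` (`Pf : Mext → QuadFlowParams` over a topological space `Mext`) whose eleven
coefficient sequences are continuous in `m` (`CoeffContinuous`) and which satisfies (A1)–(A2) with
`m`-independent constants (`∀ m, HypA1 ∧ HypA2`), on the admissible set `0 < g₀ ≤ g_thr`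
(`admSet`, `g_thr = quadThreshold`):
* `ḡ_j` is jointly continuous in `(m, g₀)` (a polynomial; `continuous_gbar_param`), and so are the
  propagators `∏(1 - ζ_kḡ_k)⁻¹`, `∏(λ_k - τ_k)⁻¹` (factors bounded away from `0`);
* `z̄_j` and `μ̄_j` are continuous on the admissible set (`continuousOn_zbar_param`,
  `continuousOn_mubar_param`) by the Weierstrass M-test (`continuousOn_tsum`) with `m`-UNIFORM summable
  majorants: `2C·K₂(ε/(1+εl))²` for `z̄` (from Lemma 2.1(ii)(b), `χ_lḡ_l² ≤ K₂(g₀/(1+g₀l))²`, monotone in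
  `g₀ ≤ ε`; `summable_sq_div_one_add`) and `K_σα^{l+1}` for `μ̄`;
* hence `V̄_j` is continuous in `(m, g₀)` on the admissible set (`continuousOn_flow_param`).

## References
* R. Bauerschmidt, D. C. Brydges, G. Slade, *Structural stability of a dynamical system near a
  non-hyperbolic fixed point*, Ann. Henri Poincaré 16 (2015), arXiv:1211.2477: Proposition 1.2 (last
  sentence), Lemma 2.1(ii)(b) (2.4), Lemma 2.2 (2.14)–(2.21), Corollary 1.8 (proof).
  [BauerschmidtBrydgesSlade2015Flow]
-/

noncomputable section

open Filter Topology Set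
open scoped BigOperators

namespace Literature.Barriers.CriticalPhenomena

namespace CTWSAW

/-! ## [BBS-rg-flow, Proposition 1.2, continuity clause]: `V̄_j` is continuous in an external
parameter (and jointly in the initial condition `g₀`) -/

section ParamContinuity

variable {Mext : Type*} [TopologicalSpace Mext]

/-- Continuity of the eleven coefficient sequences of `φ̄` in an external parameter `m`
("the maps `φ̄_j` depend continuously on an external parameter"). [cite: BauerschmidtBrydgesSlade2015Flow, Proposition 1.2 (last sentence)] -/
structure CoeffContinuous (Pf : Mext → QuadFlowParams) : Prop where
  /-- `m ↦ η_j(m)` continuous. -/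
  η : ∀ j, Continuous fun m => (Pf m).η j
  /-- `m ↦ γ_j(m)` continuous. -/
  γ : ∀ j, Continuous fun m => (Pf m).γ j
  /-- `m ↦ λ_j(m)` continuous. -/
  lam : ∀ j, Continuous fun m => (Pf m).lam j
  /-- `m ↦ β_j(m)` continuous. -/
  β : ∀ j, Continuous fun m => (Pf m).β j
  /-- `m ↦ θ_j(m)` continuous. -/
  θ : ∀ j, Continuous fun m => (Pf m).θ j
  /-- `m ↦ ζ_j(m)` continuous. -/
  ζ : ∀ j, Continuous fun m => (Pf m).ζ j
  /-- `m ↦ υ^{gg}_j(m)` continuous. -/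
  υgg : ∀ j, Continuous fun m => (Pf m).υgg j
  /-- `m ↦ υ^{gz}_j(m)` continuous. -/
  υgz : ∀ j, Continuous fun m => (Pf m).υgz j
  /-- `m ↦ υ^{gμ}_j(m)` continuous. -/
  υgμ : ∀ j, Continuous fun m => (Pf m).υgμ j
  /-- `m ↦ υ^{zz}_j(m)` continuous. -/
  υzz : ∀ j, Continuous fun m => (Pf m).υzz j
  /-- `m ↦ υ^{zμ}_j(m)` continuous. -/
  υzμ : ∀ j, Continuous fun m => (Pf m).υzμ j

variable {Pf : Mext → QuadFlowParams}

/-- `ḡ_j` is jointly continuous in `(m, g₀)` (a polynomial in `g₀` and `β₀(m), …, β_{j-1}(m)`).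
[cite: BauerschmidtBrydgesSlade2015Flow, Proposition 1.2 (continuity) and (1.7)] -/
theorem continuous_gbar_param (hP : CoeffContinuous Pf) (j : ℕ) :
    Continuous fun p : Mext × ℝ => gbar (Pf p.1).β p.2 j := by
  induction j with
  | zero => simpa using continuous_snd
  | succ j ih =>
    simp only [gbar_succ]
    exact ih.sub (((hP.β j).comp continuous_fst).mul (ih.pow 2))

/-- `∏_{k=j}^{j+l}(1 - ζ_kḡ_k)⁻¹` is jointly continuous in `(m, g₀)` on the set where the factors do
not vanish (in particular on the admissible set, where `1 - ζ_kḡ_k ≥ 1/2`).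
[cite: BauerschmidtBrydgesSlade2015Flow, Lemma 2.2 (proof) and Proposition 1.2 (continuity)] -/
theorem continuousOn_zetaInvProd_param (hP : CoeffContinuous Pf) {s : Set (Mext × ℝ)}
    (hs : ∀ p ∈ s, ∀ i, 1 - (Pf p.1).ζ i * gbar (Pf p.1).β p.2 i ≠ 0) (j l : ℕ) :
    ContinuousOn (fun p : Mext × ℝ => (Pf p.1).zetaInvProd p.2 j l) s := by
  unfold QuadFlowParams.zetaInvProd
  refine continuousOn_finsetProd _ fun i _ => ?_
  refine ContinuousOn.inv₀ ?_ fun p hp => hs p hp (i + j)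
  exact (continuous_const.sub (((hP.ζ (i + j)).comp continuous_fst).mul
    (continuous_gbar_param hP (i + j)))).continuousOn

/-- The set of admissible `(m, g₀)`: `0 < g₀ ≤ g_thr`. [cite: BauerschmidtBrydgesSlade2015Flow, Proposition 1.2 ("g₀ sufficiently small")] -/
def admSet (Mext : Type*) (gthr : ℝ) : Set (Mext × ℝ) := {p | 0 < p.2 ∧ p.2 ≤ gthr}

omit [TopologicalSpace Mext] in
/-- Membership in the admissible set. [cite: BauerschmidtBrydgesSlade2015Flow, Proposition 1.2] -/
theorem mem_admSet {gthr : ℝ} {p : Mext × ℝ} : p ∈ admSet Mext gthr ↔ 0 < p.2 ∧ p.2 ≤ gthr := Iff.rfl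

/-- `Σ_n (ε/(1+εn))² < ∞` for `ε > 0` (comparison with `max(ε,1)²/(n+1)²`). [folklore] -/
theorem summable_sq_div_one_add {ε : ℝ} (hε : 0 < ε) : Summable fun n : ℕ => (ε / (1 + ε * n)) ^ 2 := by
  have hM1 : 1 ≤ max ε 1 := le_max_right _ _
  have hMε : ε ≤ max ε 1 := le_max_left _ _
  have hb : ∀ n : ℕ, (ε / (1 + ε * n)) ^ 2 ≤ (max ε 1) ^ 2 / ((n : ℝ) + 1) ^ 2 := by
    intro n
    have hn : (0 : ℝ) ≤ n := n.cast_nonneg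
    have hden : (0 : ℝ) < 1 + ε * n := by positivity
    have h1 : ε / (1 + ε * n) ≤ max ε 1 / ((n : ℝ) + 1) := by
      rw [div_le_div_iff₀ hden (by positivity)]
      nlinarith [mul_nonneg (sub_nonneg.2 hM1) (mul_nonneg hε.le hn)]
    have h0 : 0 ≤ ε / (1 + ε * n) := by positivity
    calc (ε / (1 + ε * n)) ^ 2 ≤ (max ε 1 / ((n : ℝ) + 1)) ^ 2 := pow_le_pow_left₀ h0 h1 2
      _ = (max ε 1) ^ 2 / ((n : ℝ) + 1) ^ 2 := by rw [div_pow]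
  refine Summable.of_nonneg_of_le (fun n => by positivity) hb ?_
  have hs : Summable fun n : ℕ => 1 / ((n + 1 : ℕ) : ℝ) ^ 2 :=
    (summable_nat_add_iff 1).2 (Real.summable_one_div_nat_pow.2 one_lt_two)
  refine (hs.mul_left ((max ε 1) ^ 2)).congr fun n => ?_
  push_cast
  ring

end ParamContinuity

/-! ### Continuity of `z̄_j`, `μ̄_j` and `V̄_j` in `(m, g₀)` on the admissible set -/

section ParamContinuity2

variable {Mext : Type*} [TopologicalSpace Mext] {Pf : Mext → QuadFlowParams} {Ω B c lam C : ℝ}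

omit [TopologicalSpace Mext] in
/-- On the admissible set, (A1)–(A2) with `m`-independent constants give the hypotheses of Lemmas 2.1–2.2
at every `(m, g₀)`. [cite: BauerschmidtBrydgesSlade2015Flow, Proposition 1.2 ("(A1–A2) hold with uniform constants")] -/
theorem cutoffQuadHyp_of_mem_admSet (hΩ : 1 < Ω) (hA : ∀ m, HypA1 (Pf m).β Ω B c ∧ HypA2 (Pf m) Ω lam c C)
    {p : Mext × ℝ} (hp : p ∈ admSet Mext (quadThreshold Ω B c C lam)) :
    CutoffQuadHyp (Pf p.1) Ω (jOmega (Pf p.1).β Ω) B c ⌊c⁻¹⌋₊ C lam p.2 ∧ c * p.2 ≤ 1 / 4 ∧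
      2 * (⌊c⁻¹⌋₊ : ℝ) * (2 * B + c) * p.2 ≤ 1 / 2 :=
  cutoffQuadHyp_of_hypA hΩ (hA p.1).1 (hA p.1).2 hp.1 hp.2

omit [TopologicalSpace Mext] in
/-- The `m`-uniform termwise majorant of the `z̄`-series: on the admissible set,
`|Π^ζ_{j,l}θ_{l+j}ḡ_{l+j}²| ≤ 2C·K₂·(ε/(1+εl))²` with `ε = g_thr`, `K₂ = 16max(1,A₂)max(1,c⁻¹)²`.
[cite: BauerschmidtBrydgesSlade2015Flow, Lemma 2.2 (2.15) and Lemma 2.1(ii)(b) (2.4)] -/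
theorem abs_zbar_term_le_uniform (hΩ : 1 < Ω) (hA : ∀ m, HypA1 (Pf m).β Ω B c ∧ HypA2 (Pf m) Ω lam c C)
    {p : Mext × ℝ} (hp : p ∈ admSet Mext (quadThreshold Ω B c C lam)) (j l : ℕ) :
    |(Pf p.1).zetaInvProd p.2 j l * ((Pf p.1).θ (l + j) * gbar (Pf p.1).β p.2 (l + j) ^ 2)| ≤
      2 * C * (16 * max 1 (decayConst Ω 2) * (max 1 c⁻¹) ^ 2) *
        (quadThreshold Ω B c C lam / (1 + quadThreshold Ω B c C lam * l)) ^ 2 := by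
  obtain ⟨h, hc4, hs3⟩ := cutoffQuadHyp_of_mem_admSet hΩ hA hp
  set ε := quadThreshold Ω B c C lam with hε
  have hg0 : 0 < p.2 := hp.1
  have hgε : p.2 ≤ ε := hp.2
  have hC := h.C_nonneg
  have h1 := h.abs_zbar_term_le j l
  have h2 := h.toCutoffGbarHyp.chi_mul_gbar_rpow_le hc4 hs3 (n := 2) (by norm_num) (l + j)
  rw [Real.rpow_two, Real.rpow_two, Real.rpow_two, Real.rpow_two] at h2
  have hmono : p.2 / (1 + p.2 * ((l + j : ℕ) : ℝ)) ≤ ε / (1 + ε * l) := by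
    have hn : (0 : ℝ) ≤ ((l + j : ℕ) : ℝ) := Nat.cast_nonneg _
    have hl : (0 : ℝ) ≤ l := Nat.cast_nonneg _
    have hεp : 0 < ε := lt_of_lt_of_le hg0 hgε
    rw [div_le_div_iff₀ (by positivity) (by positivity)]
    have : (l : ℝ) ≤ ((l + j : ℕ) : ℝ) := by exact_mod_cast Nat.le_add_right l j
    nlinarith [mul_nonneg hεp.le hl, mul_nonneg (mul_nonneg hεp.le hg0.le) (sub_nonneg.2 this)]
  have hq0 : 0 ≤ p.2 / (1 + p.2 * ((l + j : ℕ) : ℝ)) := by positivity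
  have hK : 0 ≤ 16 * max 1 (decayConst Ω 2) * (max 1 c⁻¹) ^ 2 := by positivity
  calc _ ≤ 2 * C * (cutoffWeight Ω (jOmega (Pf p.1).β Ω) (l + j) * gbar (Pf p.1).β p.2 (l + j) ^ 2) := h1
    _ ≤ 2 * C * ((4:ℝ) ^ 2 * max 1 (decayConst Ω 2) * (max 1 c⁻¹) ^ 2 * (p.2 / (1 + p.2 * ((l + j : ℕ) : ℝ))) ^ 2) := by
        gcongr
    _ ≤ 2 * C * ((4:ℝ) ^ 2 * max 1 (decayConst Ω 2) * (max 1 c⁻¹) ^ 2 * (ε / (1 + ε * l)) ^ 2) := by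
        gcongr
    _ = _ := by norm_num; ring

/-- **[BBS-rg-flow, Proposition 1.2, continuity of `z̄_j`]**: for coefficient families continuous in `m`
with `m`-uniform (A1)–(A2), `(m, g₀) ↦ z̄_j(m, g₀)` is continuous on the admissible set (Weierstrass
M-test with the uniform majorant). [cite: BauerschmidtBrydgesSlade2015Flow, Proposition 1.2 (last sentence) and Lemma 2.2] -/
theorem continuousOn_zbar_param (hΩ : 1 < Ω) (hA : ∀ m, HypA1 (Pf m).β Ω B c ∧ HypA2 (Pf m) Ω lam c C)
    (hP : CoeffContinuous Pf) (j : ℕ) :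
    ContinuousOn (fun p : Mext × ℝ => (Pf p.1).zbar p.2 j) (admSet Mext (quadThreshold Ω B c C lam)) := by
  set s := admSet Mext (quadThreshold Ω B c C lam) with hs
  have hne : ∀ p ∈ s, ∀ i, 1 - (Pf p.1).ζ i * gbar (Pf p.1).β p.2 i ≠ 0 := by
    intro p hp i
    obtain ⟨h, -, -⟩ := cutoffQuadHyp_of_mem_admSet hΩ hA hp
    have := (h.toCutoffGbarHyp.one_sub_zeta_mul_gbar_mem h.zeta_le h.smallC1 i).1
    linarith
  have hf : ∀ l, ContinuousOn (fun p : Mext × ℝ =>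
      (Pf p.1).zetaInvProd p.2 j l * ((Pf p.1).θ (l + j) * gbar (Pf p.1).β p.2 (l + j) ^ 2)) s := fun l =>
    (continuousOn_zetaInvProd_param hP hne j l).mul
      ((((hP.θ (l + j)).comp continuous_fst).mul ((continuous_gbar_param hP (l + j)).pow 2)).continuousOn)
  by_cases hε : 0 < quadThreshold Ω B c C lam
  · have hu := (summable_sq_div_one_add hε).mul_left (2 * C * (16 * max 1 (decayConst Ω 2) * (max 1 c⁻¹) ^ 2))
    have := continuousOn_tsum hf hu (fun l p hp => by
      rw [Real.norm_eq_abs]; exact abs_zbar_term_le_uniform hΩ hA hp j l)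
    simpa [QuadFlowParams.zbar] using this
  · -- the admissible set is empty
    have : s = ∅ := Set.eq_empty_of_forall_notMem fun p hp => hε (lt_of_lt_of_le hp.1 hp.2)
    rw [this]; exact continuousOn_empty _

/-- Continuity of `τ_j` in `(m, g₀)` on the admissible set. [cite: BauerschmidtBrydgesSlade2015Flow, Lemma 2.2, (2.16)] -/
theorem continuousOn_tau_param (hΩ : 1 < Ω) (hA : ∀ m, HypA1 (Pf m).β Ω B c ∧ HypA2 (Pf m) Ω lam c C)
    (hP : CoeffContinuous Pf) (j : ℕ) :
    ContinuousOn (fun p : Mext × ℝ => (Pf p.1).tau p.2 j) (admSet Mext (quadThreshold Ω B c C lam)) := by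
  simp only [QuadFlowParams.tau]
  exact ((((hP.υgμ j).comp continuous_fst).mul (continuous_gbar_param hP j)).continuousOn).add
    (((hP.υzμ j).comp continuous_fst).continuousOn.mul (continuousOn_zbar_param hΩ hA hP j))

/-- Continuity of `σ_j` in `(m, g₀)` on the admissible set. [cite: BauerschmidtBrydgesSlade2015Flow, Lemma 2.2, (2.16)] -/
theorem continuousOn_sigma_param (hΩ : 1 < Ω) (hA : ∀ m, HypA1 (Pf m).β Ω B c ∧ HypA2 (Pf m) Ω lam c C)
    (hP : CoeffContinuous Pf) (j : ℕ) :
    ContinuousOn (fun p : Mext × ℝ => (Pf p.1).sigma p.2 j) (admSet Mext (quadThreshold Ω B c C lam)) := by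
  have hg := (continuous_gbar_param hP j).continuousOn (s := admSet Mext (quadThreshold Ω B c C lam))
  have hz := continuousOn_zbar_param hΩ hA hP j
  have hη := ((hP.η j).comp continuous_fst).continuousOn (s := admSet Mext (quadThreshold Ω B c C lam))
  have hγ := ((hP.γ j).comp continuous_fst).continuousOn (s := admSet Mext (quadThreshold Ω B c C lam))
  have h1 := ((hP.υgg j).comp continuous_fst).continuousOn (s := admSet Mext (quadThreshold Ω B c C lam))
  have h2 := ((hP.υgz j).comp continuous_fst).continuousOn (s := admSet Mext (quadThreshold Ω B c C lam))
  have h3 := ((hP.υzz j).comp continuous_fst).continuousOn (s := admSet Mext (quadThreshold Ω B c C lam))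
  simp only [QuadFlowParams.sigma]
  exact ((((hη.mul hg).add (hγ.mul hz)).sub (h1.mul (hg.pow 2))).sub ((h2.mul hg).mul hz)).sub (h3.mul (hz.pow 2))

/-- Continuity of `∏_{k=j}^{j+l}(λ_k - τ_k)⁻¹` in `(m, g₀)` on the admissible set (the factors are
`≥ (1+λ)/2 > 0`). [cite: BauerschmidtBrydgesSlade2015Flow, Lemma 2.2, (2.17)–(2.18)] -/
theorem continuousOn_lamInvProd_param (hΩ : 1 < Ω) (hA : ∀ m, HypA1 (Pf m).β Ω B c ∧ HypA2 (Pf m) Ω lam c C)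
    (hP : CoeffContinuous Pf) (j l : ℕ) :
    ContinuousOn (fun p : Mext × ℝ => (Pf p.1).lamInvProd p.2 j l) (admSet Mext (quadThreshold Ω B c C lam)) := by
  unfold QuadFlowParams.lamInvProd
  refine continuousOn_finsetProd _ fun i _ => ?_
  refine ContinuousOn.inv₀ ?_ fun p hp => ?_
  · exact ((hP.lam (i + j)).comp continuous_fst).continuousOn.sub (continuousOn_tau_param hΩ hA hP (i + j))
  · obtain ⟨h, -, -⟩ := cutoffQuadHyp_of_mem_admSet hΩ hA hp
    have := h.lam_sub_tau_ge (i + j); have := h.one_lt_lam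
    linarith

/-- **[BBS-rg-flow, Proposition 1.2, continuity of `μ̄_j`]** on the admissible set (M-test with the
geometric majorant `K_σ α^{l+1}`). [cite: BauerschmidtBrydgesSlade2015Flow, Proposition 1.2 (last sentence) and Lemma 2.2, (2.19)–(2.21)] -/
theorem continuousOn_mubar_param (hΩ : 1 < Ω) (hA : ∀ m, HypA1 (Pf m).β Ω B c ∧ HypA2 (Pf m) Ω lam c C)
    (hP : CoeffContinuous Pf) (j : ℕ) :
    ContinuousOn (fun p : Mext × ℝ => (Pf p.1).mubar p.2 j) (admSet Mext (quadThreshold Ω B c C lam)) := by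
  set s := admSet Mext (quadThreshold Ω B c C lam) with hs
  set N : ℕ := ⌊c⁻¹⌋₊ with hN
  set Kσ : ℝ := C * (3 + 3 * (2 * C * ((1 + N) / c + N + 2 * Ω / (Ω - 1))) +
    (2 * C * ((1 + N) / c + N + 2 * Ω / (Ω - 1))) ^ 2) / 2 with hKσ
  have hf : ∀ l, ContinuousOn (fun p : Mext × ℝ => (Pf p.1).lamInvProd p.2 j l * (Pf p.1).sigma p.2 (l + j)) s :=
    fun l => (continuousOn_lamInvProd_param hΩ hA hP j l).mul (continuousOn_sigma_param hΩ hA hP (l + j))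
  by_cases hne : s.Nonempty
  · obtain ⟨p0, hp0⟩ := hne
    obtain ⟨h0, -, -⟩ := cutoffQuadHyp_of_mem_admSet hΩ hA hp0
    have hlam := h0.one_lt_lam
    obtain ⟨hα0, hα1⟩ := h0.alpha_mem
    have hu : Summable fun l : ℕ => Kσ * (2 / (1 + lam)) ^ (l + 1) := by
      have := (summable_geometric_of_lt_one hα0 hα1).mul_left (Kσ * (2 / (1 + lam)))
      refine this.congr fun l => ?_
      rw [pow_succ]; ring
    have hbound : ∀ l p, p ∈ s → ‖(Pf p.1).lamInvProd p.2 j l * (Pf p.1).sigma p.2 (l + j)‖ ≤ Kσ * (2 / (1 + lam)) ^ (l + 1) := by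
      intro l p hp
      obtain ⟨h, -, -⟩ := cutoffQuadHyp_of_mem_admSet hΩ hA hp
      rw [Real.norm_eq_abs]
      have h1 := h.abs_mubar_term_le j l
      have hwg : cutoffWeight Ω (jOmega (Pf p.1).β Ω) j * gbar (Pf p.1).β p.2 j ≤ 1 / 2 := by
        have := h.weight_le_one j; have := h.gbar_le_half j; have := (h.gbar_pos j).le; have := (h.weight_pos j).le
        nlinarith
      have hK := h.Ksigma_nonneg
      have hαp : 0 ≤ (2 / (1 + lam) : ℝ) ^ (l + 1) := pow_nonneg hα0 _
      calc _ ≤ 2 * Kσ * (cutoffWeight Ω (jOmega (Pf p.1).β Ω) j * gbar (Pf p.1).β p.2 j) * (2 / (1 + lam)) ^ (l + 1) := h1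
        _ ≤ 2 * Kσ * (1 / 2) * (2 / (1 + lam)) ^ (l + 1) := by gcongr
        _ = Kσ * (2 / (1 + lam)) ^ (l + 1) := by ring
    have := continuousOn_tsum hf hu hbound
    simp only [QuadFlowParams.mubar]
    exact this.neg
  · rw [Set.not_nonempty_iff_eq_empty] at hne
    rw [hne]; exact continuousOn_empty _

/-- **[BBS-rg-flow, Proposition 1.2, last sentence]**: "if the maps `φ̄_j` depend continuously on an
external parameter such that (A1–A2) hold with uniform constants, then `V̄_j` is continuous in this
parameter, for every `j`" — here jointly in `(m, g₀)` on the admissible set `0 < g₀ ≤ g_thr`.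
[cite: BauerschmidtBrydgesSlade2015Flow, Proposition 1.2 (last sentence)] -/
theorem continuousOn_flow_param (hΩ : 1 < Ω) (hA : ∀ m, HypA1 (Pf m).β Ω B c ∧ HypA2 (Pf m) Ω lam c C)
    (hP : CoeffContinuous Pf) (j : ℕ) :
    ContinuousOn (fun p : Mext × ℝ => (Pf p.1).flow p.2 j) (admSet Mext (quadThreshold Ω B c C lam)) := by
  refine continuousOn_pi.2 fun i => ?_
  fin_cases i
  · simpa [QuadFlowParams.flow] using (continuous_gbar_param hP j).continuousOn
  · simpa [QuadFlowParams.flow] using continuousOn_zbar_param hΩ hA hP j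
  · simpa [QuadFlowParams.flow] using continuousOn_mubar_param hΩ hA hP j

end ParamContinuity2


end CTWSAW

end Literature.Barriers.CriticalPhenomena
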